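import Mathlib
import Summits.ValiantsHypothesis.ValiantsHypothesis.Theorems.GrenetZeonTwoDimCoefficientsDefs
import Summits.ValiantsHypothesis.ValiantsHypothesis.Theorems.GrenetZeonTwoDimCoefficientsDualUnipotentRankTransfer

/-!
# Crux `GrenetZeon.TwoDimCoefficients` (stmt-ValiantsHypothesis-8062), stub `stub_dualUnipotent`:
# trace products embed in the unipotent dual model (calibration by embedding)

The only open stub of the line `dim2_cases` is `stub_dualUnipotent : DualUnipotentBound`
(`per_n = α·det A + β·tr(adj A·B)`, `A`, `B` affine `m × m`, `det A ≡ c ≠ 0` ⟹ `n² ≤ C·m`).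
This file pins it against ONE classical quantity, the TRACE-PRODUCT WIDTH of the permanent: the
least `w` with `per_n = tr(X₁ ⋯ X_n)`, `X_i` affine `w × w` over `ℂ[x]` (`w` parallel branching
programs of width `w` closed up by a trace; contains matrix powering `tr(A^n)`, the measure `pc`
of Gesmundo–Ikenmeyer–Panova).

* `dualUnipotentRepr_of_trace_prod` — EMBEDDING: such a trace product IS a unipotent dual
  representation of size `m = n·w` (`A = 1 − N`, `N` the block-superdiagonal chain matrix of
  `X₁..X_{n−1}`, `det A = 1`, `adj A = Σ_{i<n} N^i`; `B` the corner matrix of `X_n`; only the walk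
  of length `n − 1` closes up: `tr(adj A·B) = tr(X₁ ⋯ X_n)`, `trace_adjugate_chain_mul_corner`).
* `le_two_mul_sq_of_trace_prod` — provable today, kernel-checked: `n ≤ 2·w²` (`w ≳ √(n/2)`),
  by the rank-`w` transfer `sq_le_of_dualUnipotentRepr_rank` + Mignon–Ressayre; the same order
  as the first-order flattening (`∂per_n` spans `n²` dimensions, `∂tr(X₁⋯X_n)` at most `n·w²`).
* `trace_prod_width_linear_of_dualUnipotentBound` — CALIBRATION: the stub implies a LINEAR
  trace-product width bound `n ≤ C·w` for `per_n`.  Not in print; out of reach of pointwise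
  Hessian counts (each of the `w` parallel programs has Hessian rank up to `2·n·w`, so such
  counts stop at `w ≳ √n`; cf. `…DualUnipotentHessianBlind.lean`).
Conversely (normal form N4 of `CALIBRATION-stub_dualUnipotent.md`: `per_n = b·tr(N^{n−1}M)`,
`N`, `M` linear `m × m`) a QUADRATIC width bound `n² ≤ C·w` would imply the stub: the stub sits
between the linear and the quadratic trace-product width bounds for the permanent, both open.

HONEST FRAMING: bookkeeping in the quadratic regime; the stub stays open; `VP ≠ VNP` not moved.

References: L. G. Valiant, *Completeness classes in algebra*, STOC 1979, §2; T. Mignon,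
N. Ressayre, Int. Math. Res. Not. 2004:79, Thm. 1.1; F. Gesmundo, C. Ikenmeyer, G. Panova,
*Geometric complexity theory and matrix powering*, Diff. Geom. Appl. 55 (2017), §2 (`pc`);
C. Ikenmeyer, J. M. Landsberg, J. Pure Appl. Algebra 221 (2017), Def. 2.2, Thm. 4.1.
-/


-- single-conjunct layout `Summits/ValiantsHypothesis/ValiantsHypothesis`: the duplicated namespace
-- component is mandated by the tree.
set_option linter.dupNamespace false

noncomputable section

namespace Summit.ValiantsHypothesis.ValiantsHypothesis.Cruxes.TwoDimCoefficients.DimTwoCases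

open Literature.Computability.AlgebraicComplexity Matrix MvPolynomial

/-! ### Layered (block-superdiagonal) matrices: nilpotency, `det (1 − N) = 1`, `adj (1 − N) = Σ N^i` -/

section Layered

variable {R : Type*} [CommRing R] {n w : ℕ}
  (N : Matrix (Fin (n + 1) × Fin w) (Fin (n + 1) × Fin w) R)

/-- In a block-superdiagonal matrix every non-zero entry of `N ^ i` raises the block index by
exactly `i` (all walks of length `i` in a layered graph climb `i` layers). [cite: Valiant1979, §2] -/
theorem layered_pow_apply_ne_zero (hN : ∀ p q, N p q ≠ 0 → (q.1 : ℕ) = p.1 + 1) :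
    ∀ (i : ℕ) (p q : Fin (n + 1) × Fin w), (N ^ i) p q ≠ 0 → (q.1 : ℕ) = p.1 + i := by
  intro i
  induction i with
  | zero =>
    intro p q h
    by_cases hpq : p = q
    · subst hpq; simp
    · exact absurd (by rw [pow_zero, Matrix.one_apply_ne hpq]) h
  | succ i ih =>
    intro p q h
    rw [pow_succ, Matrix.mul_apply] at h
    obtain ⟨r, -, hr⟩ := Finset.exists_ne_zero_of_sum_ne_zero h
    rw [hN r q (fun h0 => hr (by rw [h0, mul_zero])), ih p r (fun h0 => hr (by rw [h0, zero_mul]))]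
    ring

/-- A block-superdiagonal matrix with `n + 1` block rows satisfies `N ^ (n + 1) = 0`.
[cite: Valiant1979, §2] -/
theorem layered_pow_eq_zero (hN : ∀ p q, N p q ≠ 0 → (q.1 : ℕ) = p.1 + 1) :
    N ^ (n + 1) = 0 := by
  refine Matrix.ext fun p q => ?_
  rw [Matrix.zero_apply]
  by_contra h
  have h1 := layered_pow_apply_ne_zero N hN (n + 1) p q h
  have h2 := q.1.isLt
  omega

/-- `1 − N` is block upper-triangular for the block index. [folklore] -/
theorem layered_blockTriangular_one_sub (hN : ∀ p q, N p q ≠ 0 → (q.1 : ℕ) = p.1 + 1) :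
    (1 - N).BlockTriangular Prod.fst := by
  intro p q hpq
  have hne : p ≠ q := by rintro rfl; exact lt_irrefl _ hpq
  have hz : N p q = 0 := by
    by_contra h
    have h1 := hN p q h
    have h2 : (q.1 : ℕ) < p.1 := hpq
    omega
  simp [Matrix.sub_apply, Matrix.one_apply_ne hne, hz]

/-- The diagonal blocks of `1 − N` are identity matrices (no edge inside a block row).
[folklore] -/
theorem layered_toSquareBlock_one_sub (hN : ∀ p q, N p q ≠ 0 → (q.1 : ℕ) = p.1 + 1)
    (k : Fin (n + 1)) : (1 - N).toSquareBlock Prod.fst k = 1 := by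
  ext ⟨p, hp⟩ ⟨q, hq⟩
  have hz : N p q = 0 := by
    by_contra h
    have h1 := hN p q h
    have h2 : (p.1 : ℕ) = q.1 := by rw [hp, hq]
    omega
  by_cases hpq : p = q
  · subst hpq
    simp [Matrix.toSquareBlock_def, hz]
  · have hne : (⟨p, hp⟩ : {a // a.1 = k}) ≠ ⟨q, hq⟩ := fun h => hpq (congrArg Subtype.val h)
    simp [Matrix.toSquareBlock_def, Matrix.one_apply_ne hpq, Matrix.one_apply_ne hne, hz]

/-- **`det (1 − N) = 1`**: `1 − N` is block-unitriangular. [folklore] -/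
theorem layered_det_one_sub (hN : ∀ p q, N p q ≠ 0 → (q.1 : ℕ) = p.1 + 1) : (1 - N).det = 1 := by
  classical
  rw [(layered_blockTriangular_one_sub N hN).det_fintype]
  refine Finset.prod_eq_one fun k _ => ?_
  rw [layered_toSquareBlock_one_sub N hN k, Matrix.det_one]

/-- **Geometric series**: `(1 − N)⁻¹ = Σ_{i ≤ n} N^i`. [cite: Valiant1979, §2] -/
theorem layered_inv_one_sub (hN : ∀ p q, N p q ≠ 0 → (q.1 : ℕ) = p.1 + 1) :
    (1 - N)⁻¹ = ∑ i ∈ Finset.range (n + 1), N ^ i := by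
  have h : (1 - N) * ∑ i ∈ Finset.range (n + 1), N ^ i = 1 := by
    rw [mul_neg_geom_sum, layered_pow_eq_zero N hN, sub_zero]
  exact Matrix.inv_eq_right_inv h

/-- **`adj (1 − N) = Σ_{i ≤ n} N^i`** (the adjugate of a matrix of determinant `1` is its inverse).
[cite: Valiant1979, §2] -/
theorem layered_adjugate_one_sub (hN : ∀ p q, N p q ≠ 0 → (q.1 : ℕ) = p.1 + 1) :
    (1 - N).adjugate = ∑ i ∈ Finset.range (n + 1), N ^ i := by
  rw [← layered_inv_one_sub N hN, Matrix.inv_def, layered_det_one_sub N hN, Ring.inverse_one,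
    one_smul]

end Layered

/-! ### The chain matrix of `X₀, …, X_n` and the corner matrix: `tr(adj(1 − N)·B) = tr(X₀ ⋯ X_n)` -/

section Chain

variable {R : Type*} [CommRing R] {n w : ℕ} (X : Fin (n + 1) → Matrix (Fin w) (Fin w) R)
  (N B : Matrix (Fin (n + 1) × Fin w) (Fin (n + 1) × Fin w) R)

/-- The CHAIN matrix (block `(i, i+1)` equal to `X_i`) is block-superdiagonal. [folklore] -/
theorem chain_layered
    (hN : ∀ p q, N p q = if (q.1 : ℕ) = p.1 + 1 then X p.1 p.2 q.2 else 0) :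
    ∀ p q, N p q ≠ 0 → (q.1 : ℕ) = p.1 + 1 := by
  intro p q h
  rw [hN p q] at h
  by_contra hne
  exact h (if_neg hne)

/-- Walks of length `j` from block row `0` in the chain matrix: the `(0, j)` block of `N ^ j` is the
prefix product `X₀ X₁ ⋯ X_{j−1}`. [cite: Valiant1979, §2] -/
theorem chain_pow_apply
    (hN : ∀ p q, N p q = if (q.1 : ℕ) = p.1 + 1 then X p.1 p.2 q.2 else 0) :
    ∀ (j : ℕ) (hj : j < n + 1) (a b : Fin w),
      (N ^ j) (0, a) (⟨j, hj⟩, b) = ((List.ofFn X).take j).prod a b := by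
  intro j
  induction j with
  | zero =>
    intro hj a b
    have h0 : (⟨0, hj⟩ : Fin (n + 1)) = 0 := Fin.ext rfl
    rw [h0, pow_zero, List.take_zero, List.prod_nil]
    by_cases hab : a = b
    · subst hab
      rw [Matrix.one_apply_eq, Matrix.one_apply_eq]
    · have hne : ((0 : Fin (n + 1)), a) ≠ ((0 : Fin (n + 1)), b) :=
        fun h => hab (Prod.ext_iff.1 h).2
      rw [Matrix.one_apply_ne hne, Matrix.one_apply_ne hab]
  | succ j ih =>
    intro hj a b
    have hj' : j < n + 1 := Nat.lt_of_succ_lt hj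
    have hlen : j < (List.ofFn X).length := by rw [List.length_ofFn]; exact hj'
    rw [List.prod_take_succ _ _ hlen, List.getElem_ofFn, pow_succ, Matrix.mul_apply,
      Matrix.mul_apply, Fintype.sum_prod_type, Finset.sum_eq_single (⟨j, hj'⟩ : Fin (n + 1))]
    · refine Finset.sum_congr rfl fun c _ => ?_
      rw [ih hj' a c, hN]
      simp
    · intro i _ hi
      refine Finset.sum_eq_zero fun c _ => ?_
      have hne : ¬ ((⟨j + 1, hj⟩ : Fin (n + 1)) : ℕ) = ((i, c) : Fin (n + 1) × Fin w).1 + 1 := by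
        intro h
        apply hi
        apply Fin.ext
        change (i : ℕ) = j
        change j + 1 = (i : ℕ) + 1 at h
        omega
      rw [hN, if_neg hne, mul_zero]
    · exact fun h => absurd (Finset.mem_univ _) h

/-- `tr(N^i·B)` for the chain matrix `N` and the CORNER matrix `B` (block `(n, 0)` equal to `X_n`):
only `i = n` closes a walk, and then the trace is `tr(X₀ ⋯ X_n)`. [cite: Valiant1979, §2] -/
theorem trace_chain_pow_mul_corner
    (hN : ∀ p q, N p q = if (q.1 : ℕ) = p.1 + 1 then X p.1 p.2 q.2 else 0)
    (hB : ∀ p q, B p q = if p.1 = Fin.last n ∧ q.1 = 0 then X (Fin.last n) p.2 q.2 else 0)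
    (i : ℕ) : (N ^ i * B).trace = if i = n then ((List.ofFn X).prod).trace else 0 := by
  -- reduce the trace to the `(0, n)` block of `N ^ i` against `X_n`
  have key : (N ^ i * B).trace = ∑ a : Fin w, ∑ b : Fin w,
      (N ^ i) (0, a) (Fin.last n, b) * X (Fin.last n) b a := by
    rw [Matrix.trace]
    simp only [Matrix.diag_apply, Matrix.mul_apply]
    rw [Fintype.sum_prod_type, Finset.sum_eq_single (0 : Fin (n + 1))]
    · refine Finset.sum_congr rfl fun a _ => ?_
      rw [Fintype.sum_prod_type, Finset.sum_eq_single (Fin.last n)]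
      · refine Finset.sum_congr rfl fun b _ => ?_
        rw [hB]
        simp
      · intro k _ hk
        refine Finset.sum_eq_zero fun b _ => ?_
        rw [hB]
        simp [hk]
      · exact fun h => absurd (Finset.mem_univ _) h
    · intro k _ hk
      refine Finset.sum_eq_zero fun a _ => Finset.sum_eq_zero fun q _ => ?_
      rw [hB]
      simp [hk]
    · exact fun h => absurd (Finset.mem_univ _) h
  rw [key]
  by_cases hi : i = n
  · subst hi
    rw [if_pos rfl]
    have hlast : (Fin.last i : Fin (i + 1)) = ⟨i, Nat.lt_succ_self i⟩ := rfl
    simp_rw [hlast, chain_pow_apply X N hN i (Nat.lt_succ_self i)]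
    have hlen : i < (List.ofFn X).length := by rw [List.length_ofFn]; exact Nat.lt_succ_self i
    have hfull : (List.ofFn X).take (i + 1) = List.ofFn X :=
      List.take_of_length_le (by rw [List.length_ofFn])
    have hprod : (List.ofFn X).prod = ((List.ofFn X).take i).prod * X ⟨i, Nat.lt_succ_self i⟩ := by
      conv_lhs => rw [← hfull]
      rw [List.prod_take_succ _ _ hlen, List.getElem_ofFn]
    rw [hprod, Matrix.trace]
    simp only [Matrix.diag_apply, Matrix.mul_apply]
  · rw [if_neg hi]
    refine Finset.sum_eq_zero fun a _ => Finset.sum_eq_zero fun b _ => ?_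
    have hz : (N ^ i) (0, a) (Fin.last n, b) = 0 := by
      by_contra h
      have h1 := layered_pow_apply_ne_zero N (chain_layered X N hN) i _ _ h
      simp only [Fin.val_last, Fin.val_zero, zero_add] at h1
      exact hi h1.symm
    rw [hz, zero_mul]

/-- **`tr(adj(1 − N)·B) = tr(X₀ X₁ ⋯ X_n)`** for the chain matrix `N` of `X₀, …, X_{n−1}` and the
corner matrix `B` of `X_n`. [cite: Valiant1979, §2] -/
theorem trace_adjugate_chain_mul_corner
    (hN : ∀ p q, N p q = if (q.1 : ℕ) = p.1 + 1 then X p.1 p.2 q.2 else 0)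
    (hB : ∀ p q, B p q = if p.1 = Fin.last n ∧ q.1 = 0 then X (Fin.last n) p.2 q.2 else 0) :
    ((1 - N).adjugate * B).trace = ((List.ofFn X).prod).trace := by
  rw [layered_adjugate_one_sub N (chain_layered X N hN), Finset.sum_mul, Matrix.trace_sum]
  simp_rw [trace_chain_pow_mul_corner X N B hN hB]
  rw [Finset.sum_ite_eq' (Finset.range (n + 1)) n, if_pos (Finset.self_mem_range_succ n)]

/-- The trace is invariant under re-indexing along an equivalence. [folklore] -/
theorem trace_reindex_self {ι κ : Type*} [Fintype ι] [Fintype κ] (e : ι ≃ κ) (M : Matrix ι ι R) :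
    (Matrix.reindex e e M).trace = M.trace := by
  simp only [Matrix.trace, Matrix.reindex_apply, Matrix.diag_apply, Matrix.submatrix_apply]
  exact Equiv.sum_comp e.symm (fun i => M i i)

end Chain

/-! ### The embedding into the unipotent dual model (transport to `Fin ((n+1)·w)`) -/

section Embedding

variable {n w : ℕ}

/-- **The embedding data.**  For affine `w × w` factors `X₀, …, X_k` over `ℂ[x]`: the re-indexed
`A = 1 − N` (`N` the chain matrix of `X₀, …, X_{k−1}`) and corner matrix `B` of `X_k` are affine of
size `(k+1)·w`, `det A = 1`, `tr(adj A·B) = tr(X₀ ⋯ X_k)`, and `B = U·V₀` factors through the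
constant `w × (k+1)w` selector `V₀` of block `0` (row-rank `w`). [cite: Valiant1979, §2] -/
theorem exists_chain_embedding {k : ℕ} (X : Fin (k + 1) → AffMat (k + 1) w)
    (hX : ∀ i, IsAffine (X i)) :
    ∃ (A B : AffMat (k + 1) ((k + 1) * w))
      (U : Matrix (Fin ((k + 1) * w)) (Fin w) (MvPolynomial (Fin (k + 1) × Fin (k + 1)) ℂ))
      (V : Matrix (Fin w) (Fin ((k + 1) * w)) ℂ),
      IsAffine A ∧ IsAffine B ∧ (∀ u c, (U u c).totalDegree ≤ 1) ∧
        (∀ u v, B u v = ∑ c, U u c * MvPolynomial.C (V c v)) ∧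
        A.det = MvPolynomial.C 1 ∧ (A.adjugate * B).trace = ((List.ofFn X).prod).trace := by
  let N : Matrix (Fin (k + 1) × Fin w) (Fin (k + 1) × Fin w)
      (MvPolynomial (Fin (k + 1) × Fin (k + 1)) ℂ) :=
    Matrix.of fun p q => if (q.1 : ℕ) = p.1 + 1 then X p.1 p.2 q.2 else 0
  let B : Matrix (Fin (k + 1) × Fin w) (Fin (k + 1) × Fin w)
      (MvPolynomial (Fin (k + 1) × Fin (k + 1)) ℂ) :=
    Matrix.of fun p q => if p.1 = Fin.last k ∧ q.1 = 0 then X (Fin.last k) p.2 q.2 else 0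
  have hN : ∀ p q, N p q = if (q.1 : ℕ) = p.1 + 1 then X p.1 p.2 q.2 else 0 := fun _ _ => rfl
  have hB : ∀ p q, B p q = if p.1 = Fin.last k ∧ q.1 = 0 then X (Fin.last k) p.2 q.2 else 0 :=
    fun _ _ => rfl
  let e : Fin (k + 1) × Fin w ≃ Fin ((k + 1) * w) := finProdFinEquiv
  let U : Matrix (Fin ((k + 1) * w)) (Fin w) (MvPolynomial (Fin (k + 1) × Fin (k + 1)) ℂ) :=
    fun u c => if (e.symm u).1 = Fin.last k then X (Fin.last k) (e.symm u).2 c else 0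
  let V : Matrix (Fin w) (Fin ((k + 1) * w)) ℂ :=
    fun c v => if (e.symm v).1 = 0 ∧ (e.symm v).2 = c then 1 else 0
  refine ⟨Matrix.reindex e e (1 - N), Matrix.reindex e e B, U, V, ?_, ?_, ?_, ?_, ?_, ?_⟩
  · -- `1 − N` is affine
    intro u v
    rw [Matrix.reindex_apply, Matrix.submatrix_apply, Matrix.sub_apply, hN]
    refine (totalDegree_sub _ _).trans (max_le ?_ ?_)
    · by_cases huv : e.symm u = e.symm v
      · rw [huv]; simp
      · simp [Matrix.one_apply_ne huv]
    · split_ifs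
      · exact hX _ _ _
      · simp
  · -- `B` is affine
    intro u v
    rw [Matrix.reindex_apply, Matrix.submatrix_apply, hB]
    split_ifs
    · exact hX _ _ _
    · simp
  · -- `U` is affine
    intro u c
    simp only [U]
    split_ifs
    · exact hX _ _ _
    · simp
  · -- `B = U · V₀`
    intro u v
    rw [Matrix.reindex_apply, Matrix.submatrix_apply, hB]
    simp only [U, V]
    by_cases h1 : (e.symm u).1 = Fin.last k
    · simp only [h1, true_and, if_true]
      by_cases h2 : (e.symm v).1 = 0
      · simp only [h2, true_and, if_true]
        rw [Finset.sum_eq_single (e.symm v).2]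
        · simp
        · intro c _ hc
          rw [if_neg (Ne.symm hc), map_zero, mul_zero]
        · exact fun hc => absurd (Finset.mem_univ _) hc
      · simp [h2]
    · simp [h1]
  · rw [Matrix.det_reindex_self, layered_det_one_sub N (chain_layered X N hN), map_one]
  · rw [Matrix.adjugate_reindex, Matrix.reindex_apply, Matrix.reindex_apply,
      Matrix.submatrix_mul_equiv, ← Matrix.reindex_apply, trace_reindex_self,
      trace_adjugate_chain_mul_corner X N B hN hB]

/-- **EMBEDDING: a trace product is a unipotent dual representation of size `n·w`.**  If
`per_n = tr(X₁ ⋯ X_n)` with `n ≥ 1` affine `w × w` matrices `X_i` over `ℂ[x_{ij}]`, then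
`DualUnipotentRepr n (n·w)` holds (`α = 0`, `β = c = 1`, `A = 1 − N` the chain matrix,
`B` the corner matrix). [cite: Valiant1979, §2] -/
theorem dualUnipotentRepr_of_trace_prod (hn : 1 ≤ n) (X : Fin n → AffMat n w)
    (hX : ∀ i, IsAffine (X i)) (h : perPoly (Fin n) ℂ = ((List.ofFn X).prod).trace) :
    DualUnipotentRepr n (n * w) := by
  obtain ⟨k, rfl⟩ : ∃ k, n = k + 1 := ⟨n - 1, by omega⟩
  obtain ⟨A, B, -, -, hA, hB, -, -, hdet, htr⟩ := exists_chain_embedding X hX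
  refine ⟨0, 1, 1, A, B, hA, hB, one_ne_zero, hdet, ?_⟩
  rw [htr, map_zero, zero_mul, zero_add, map_one, one_mul, h]

/-- **Matrix powering** is the special case `X₁ = ⋯ = X_n = A`: if `per_n = tr(A^n)` with `A` an
affine `w × w` matrix (`n ≥ 1`), then `DualUnipotentRepr n (n·w)`.  (For pure powering the
stub's consequence `w ≥ n/C` is below the first-order flattening bound `pc(per_n) ≥ n`; the
content is in products of DISTINCT factors.) [cite: GesmundoIkenmeyerPanova2017, §2 (the measure `pc`)] -/
theorem dualUnipotentRepr_of_trace_pow (hn : 1 ≤ n) (A : AffMat n w) (hA : IsAffine A)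
    (h : perPoly (Fin n) ℂ = (A ^ n).trace) : DualUnipotentRepr n (n * w) := by
  refine dualUnipotentRepr_of_trace_prod hn (fun _ => A) (fun _ => hA) ?_
  rw [h, List.ofFn_const, List.prod_replicate]

/-- **What is provable today for trace products (kernel-checked `√n`).**  If
`per_n = tr(X₁ ⋯ X_n)` with affine `w × w` factors and `n ≥ 3`, then `n ≤ 2·w²`: the corner
direction has constant row-rank `w`, so `per_n` is one affine determinant of size `n·w·w + 1`
(`hasDetRepr_of_dualUnipotentRepr_rank`) and Mignon–Ressayre gives `n² ≤ 2(n·w·w + 1)`.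
[cite: MignonRessayre2004, Thm. 1.1] -/
theorem le_two_mul_sq_of_trace_prod (hn : 3 ≤ n) (X : Fin n → AffMat n w)
    (hX : ∀ i, IsAffine (X i)) (h : perPoly (Fin n) ℂ = ((List.ofFn X).prod).trace) :
    n ≤ 2 * w ^ 2 := by
  obtain ⟨k, rfl⟩ : ∃ k, n = k + 1 := ⟨n - 1, by omega⟩
  obtain ⟨A, B, U, V, hA, -, hU, hBUV, hdet, htr⟩ := exists_chain_embedding X hX
  have hrep : perPoly (Fin (k + 1)) ℂ =
      MvPolynomial.C 0 * A.det + MvPolynomial.C 1 * (A.adjugate * B).trace := by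
    rw [htr, map_zero, zero_mul, zero_add, map_one, one_mul, h]
  have hsq := sq_le_of_dualUnipotentRepr_rank hn 0 1 1 one_ne_zero A B U V hA hU hBUV hdet hrep
  -- `(k+1)² ≤ 2((k+1)·w·w + 1)` with `k + 1 ≥ 3` forces `k + 1 ≤ 2 w²`
  by_contra hlt
  have h3 : 2 * w ^ 2 + 1 ≤ k + 1 := Nat.lt_of_not_le hlt
  have h4 : (k + 1) * (2 * w ^ 2 + 1) ≤ (k + 1) * (k + 1) := Nat.mul_le_mul_left _ h3
  nlinarith [h4, hsq]

/-- **CALIBRATION: `DualUnipotentBound` ⟹ LINEAR trace-product width for the permanent.**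
If the stub `stub_dualUnipotent` holds then there are `C`, `n₀` with: `per_n = tr(X₁ ⋯ X_n)`
(`n ≥ n₀`, affine `w × w` factors) forces `n ≤ C·w`.  No such bound is in print (record: the `√n`
of `le_two_mul_sq_of_trace_prod`); pointwise Hessian counts cannot reach it. [folklore] -/
theorem trace_prod_width_linear_of_dualUnipotentBound (hD : DualUnipotentBound) :
    ∃ C n₀ : ℕ, ∀ n ≥ n₀, ∀ (w : ℕ) (X : Fin n → AffMat n w), (∀ i, IsAffine (X i)) →
      perPoly (Fin n) ℂ = ((List.ofFn X).prod).trace → n ≤ C * w := by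
  obtain ⟨C, n₀, hC⟩ := hD
  refine ⟨C, max n₀ 1, fun n hn w X hX h => ?_⟩
  have hn₀ : n₀ ≤ n := le_of_max_le_left hn
  have hn1 : 1 ≤ n := le_of_max_le_right hn
  have hb := hC n hn₀ (n * w) (dualUnipotentRepr_of_trace_prod hn1 X hX h)
  have hb' : n * n ≤ n * (C * w) := by
    calc n * n = n ^ 2 := (sq n).symm
      _ ≤ C * (n * w) := hb
      _ = n * (C * w) := by ring
  exact Nat.le_of_mul_le_mul_left hb' (by omega)

end Embedding

end Summit.ValiantsHypothesis.ValiantsHypothesis.Cruxes.TwoDimCoefficients.DimTwoCases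

end
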